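import Summits.NavierStokesRegularity.NavierStokesRegularity.Theorems.TerminalTraceTypeITraceScarL3ExtinctApexZoomData
import Literature.Analysis.FluidPDE.LocalPlainPressureBound
import HarnessLib

/-!
# Line `apex-dichotomy` of `TerminalTrace.TypeITraceScarL3` (stmt-NavierStokesRegularity-18385), Stub 2′ at
# unit viscosity: the extinct Type-I apex carries a PLAIN `D`-bound of its pressure at every apex

Seat ns-typeII-p3 g9 (cell ns-regularity-ideate), planner-of-record nsreg-p2 g27 (RULING 23:01Z «p3 takes 2′»),
`--supports stmt-NavierStokesRegularity-18385`.  Stub 2′ `stub_extinctApexD_of_L3trace` of the registered skeleton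
`apex-dichotomy` (sha16 95aa062ef93d7802) = Stub 2 of `extinct-apex` (landed: `stub_extinctApex_of_L3trace`, p581640)
plus ONE clause: the scale-invariant PLAIN pressure quantity `D(Q_r(z₀))[P] = cknD r z₀ P` (NOT mean-free — the `hP`
of the tree's ESS endgame `ancient_lintegral_cube_eq_zero_of_farField_le`) is bounded at every apex `z₀.1 ≤ 0`
and every radius.  This file proves it at `ν = 1`:

* `extinctApexD_of_L3trace_unit` — hypotheses of `extinctApex_of_L3trace_unit`; conclusion = its six clauses
  plus `∀ z₀, z₀.1 ≤ 0 → ∀ r > 0, cknD r z₀ P ≤ D₀`.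

Assembly (nsreg-typer g19's tools `Literature/Analysis/FluidPDE/LocalPlainPressureBound.lean`, p582674, on the
data exported by `exists_extinctApex_zoomData_unit`, p581891): in the frame of the viscosity-normalising zoom
`v = R u(T + R²·, x₀ + R·)`, `πv = R² q(…)` (`q = p − (p(t,0) − p̃[u(t)](0))`, Tao's gauge) — a suitable pair in
`Q(0, 1)` with `𝐈(Q(0, 1/2)) =: M₁ < ⊤` (`exists_zoom_typeIBound_lt_top_of_morrey` + `morrey_of_typeI`) —
`cknC ≤ M₁` on the sub-cylinders of `Q(0, 1/2)` (`cknC_le_of_typeIBound_le`) and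
`M₂ := cknD (1/2) 0 πv < ⊤` (`πv ∈ L^{3/2}(Q(0,1))`), so Seregin–Šverák's iterated pressure decay
(`exists_cknD_le_window_of_cknC_le`) bounds the plain `cknD r z πv ≤ κ(M₁ + M₂)` on the window
`z.1 ∈ [−3/16, 0]`, `|z.2| < 1/4`, `r ≤ 1/4`; the zoomed pressures of the zoom data are `(μ_j/R)`-zooms of `πv`
(`zoom_zoom_pressure`), so `blowup_cknD_le_apex_of_tendsto` (weak lower semicontinuity of `∫_{Q_r(z)}|·|^{3/2}`,
Wang–Zhang (4.3)–(4.4)) transfers the bound to the limit pressure `P` at every apex.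

WHAT THIS IS NOT: not NS regularity, not item 18385, not Stub B/C — bookkeeping; after Stub 2′ and Stub B the line
`apex-dichotomy` is the item modulo exactly Stub C `stub_no_spreadExtinctApex` (the hard core).  [folklore;
AlbrittonBarker2019 §3; SereginSverak2009 (as13); WangZhang2016 §4 (4.3)–(4.4); Seregin2014 §6.6]
-/

noncomputable section

set_option linter.dupNamespace false

namespace Summit.NavierStokesRegularity.NavierStokesRegularity.Theorems.TypeITraceScarL3

open MeasureTheory Set Function Filter Topology TopologicalSpace Metric
open Literature.Analysis.FluidPDE
open scoped NNReal ENNReal InnerProductSpace RealInnerProductSpace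

/-- **Stub 2′ of line `apex-dichotomy` at unit viscosity.** `T > 0`, `(u, p)` classical on `ℝ³ × [0, T)`
(`ν = 1`) and Leray–Hopf on `[0, T]`, Type-I in time, NOT backward bounded at `(T, x₀)`, with
`u(T) ∈ L³(B(x₀, ρ))`: then there is an extinct Type-I apex `(U, P, G, M, D₀, C)` — suitable in every `Q(a)`
with weak gradient `G`, `𝐈(Q(a)) ≤ M`, PLAIN `D(Q_r(z₀))[P] ≤ D₀` at every apex `z₀.1 ≤ 0` and every radius,
rate `C/√(−s)` a.e. on every slice, weakly vanishing at the top time, backward-singular at the origin.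
[folklore; AlbrittonBarker2019 §3; SereginSverak2009 (as13); WangZhang2016 §4; Seregin2014 §6.6] -/
theorem extinctApexD_of_L3trace_unit {T : ℝ} (hT : 0 < T)
    {u : ℝ → EuclideanSpace ℝ (Fin 3) → EuclideanSpace ℝ (Fin 3)} {p : ℝ → EuclideanSpace ℝ (Fin 3) → ℝ}
    (hsol : IsClassicalNSSolutionOn (Ico 0 T) 1 0 u p) (hLH : IsLerayHopfOn T 1 0 (u 0) u)
    (hI : IsTypeIBlowup u T) (x₀ : EuclideanSpace ℝ (Fin 3)) (hnotbd : ¬ IsBackwardBoundedAt u T x₀)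
    {ρ : ℝ} (hρ : 0 < ρ) (htr : MemLp (u T) 3 (volume.restrict (ball x₀ ρ))) :
    ∃ (U : ℝ → EuclideanSpace ℝ (Fin 3) → EuclideanSpace ℝ (Fin 3)) (P : ℝ → EuclideanSpace ℝ (Fin 3) → ℝ)
      (G : ℝ → EuclideanSpace ℝ (Fin 3) → EuclideanSpace ℝ (Fin 3) →L[ℝ] EuclideanSpace ℝ (Fin 3))
      (M D₀ : ℝ≥0) (C : ℝ),
      (∀ a : ℝ, 0 < a → IsSuitableWeakSolutionInBall a (0 : ℝ × EuclideanSpace ℝ (Fin 3)) U P) ∧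
      (∀ a : ℝ, 0 < a →
        HasWeakSpatialGradientOn (parabolicCylinderOpens a (0 : ℝ × EuclideanSpace ℝ (Fin 3))) U G) ∧
      (∀ a : ℝ, 0 < a → typeIBound (parabolicCylinder a (0 : ℝ × EuclideanSpace ℝ (Fin 3))) U P G ≤ M) ∧
      (∀ z₀ : ℝ × EuclideanSpace ℝ (Fin 3), z₀.1 ≤ 0 → ∀ r : ℝ, 0 < r → cknD r z₀ P ≤ D₀) ∧
      (∀ s : ℝ, s < 0 → ∀ᵐ y : EuclideanSpace ℝ (Fin 3), ‖U s y‖ ≤ C / Real.sqrt (-s)) ∧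
      (∀ φ : EuclideanSpace ℝ (Fin 3) → EuclideanSpace ℝ (Fin 3), ContDiff ℝ (⊤ : ℕ∞) φ →
        HasCompactSupport φ → ∀ ε : ℝ, 0 < ε →
          ∃ s₀ : ℝ, s₀ < 0 ∧ ∀ᵐ s ∂(volume.restrict (Ioo s₀ 0)), |∫ y, ⟪U s y, φ y⟫| ≤ ε) ∧
      IsBackwardSingularPoint U (0 : ℝ × EuclideanSpace ℝ (Fin 3)) := by
  -- ## (1) the apex with its zoom data
  obtain ⟨μ, U, P, G, M, C, hμ, hμ0, h1, h2, h3, h4, h5, h6, hdata⟩ :=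
    exists_extinctApex_zoomData_unit hT hsol hLH hI x₀ hnotbd hρ htr
  -- ## (2) the vertex frame: `v = R u(T + R²·, x₀ + R·)`, `πv = R² q(…)`, with `𝐈(Q(0,1/2)) < ⊤`
  obtain ⟨r₀, M₀, T₁, hr₀, hT₁, hMor⟩ := morrey_of_typeI one_pos hT hsol hLH hI
  obtain ⟨R, α, β, hR, hα, hβ, hβeq, hαeq, hβT, hball, hGv, htypeI⟩ :=
    exists_zoom_typeIBound_lt_top_of_morrey one_pos hT hsol hLH hr₀ hT₁ hMor x₀
  rw [div_one] at hβeq hαeq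
  set q : ℝ → EuclideanSpace ℝ (Fin 3) → ℝ :=
    fun t x => p t x - (p t 0 - normalisedPressure (u t) 0) with hq
  set v : ℝ → EuclideanSpace ℝ (Fin 3) → EuclideanSpace ℝ (Fin 3) := α • stPull β R T x₀ u with hv
  set πv : ℝ → EuclideanSpace ℝ (Fin 3) → ℝ := α ^ 2 • stPull β R T x₀ q with hπv
  set Gv : ℝ → EuclideanSpace ℝ (Fin 3) → EuclideanSpace ℝ (Fin 3) →L[ℝ] EuclideanSpace ℝ (Fin 3) :=
    (α * R) • stPull β R T x₀ (fun t x => fderiv ℝ (u t) x) with hGvdef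
  have hπv1 : πv = R ^ 2 • stPull (R ^ 2) R T x₀ q := by rw [hπv, hαeq, hβeq]
  set z₀ : ℝ × EuclideanSpace ℝ (Fin 3) := ((0 : ℝ), (0 : EuclideanSpace ℝ (Fin 3))) with hz₀
  have hz₀0 : z₀ = 0 := rfl
  -- the distributional pair on `Q(0,1)` and the sub-cylinder `Q(0, 1/2)`
  have hdist : IsDistributionalNSSolutionOn
      (parabolicCylinderOpens 1 (0 : ℝ × EuclideanSpace ℝ (Fin 3))) 1 0 v πv := hball.1.distributional
  have hsub : parabolicCylinder (1 / 2) z₀ ⊆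
      ((parabolicCylinderOpens 1 (0 : ℝ × EuclideanSpace ℝ (Fin 3)) :
        Opens (ℝ × EuclideanSpace ℝ (Fin 3))) : Set (ℝ × EuclideanSpace ℝ (Fin 3))) := by
    rw [coe_parabolicCylinderOpens, hz₀0]
    exact SuitableCompactness.parabolicCylinder_zero_mono (by norm_num) (by norm_num)
  -- `M₁ = 𝐈(Q(0, 1/2))` bounds `C` on every sub-cylinder
  set M₁ : ℝ≥0∞ := typeIBound (parabolicCylinder (1 / 2) (0 : ℝ × EuclideanSpace ℝ (Fin 3))) v πv Gv
    with hM₁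
  have hM₁top : M₁ ≠ ⊤ := htypeI.ne
  have hC : ∀ (z : ℝ × EuclideanSpace ℝ (Fin 3)) (r : ℝ), 0 < r →
      parabolicCylinder r z ⊆ parabolicCylinder (1 / 2) z₀ → cknC r z v ≤ M₁ := by
    intro z r hr hz
    rw [hz₀0] at hz
    exact cknC_le_of_typeIBound_le (le_refl M₁) subset_rfl hr hz
  -- `M₂ = D(Q(0, 1/2))[πv]` is finite (`πv ∈ L^{3/2}(Q(0,1))`)
  set M₂ : ℝ≥0∞ := cknD (1 / 2) z₀ πv with hM₂
  have hM₂top : M₂ ≠ ⊤ := by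
    obtain ⟨h32, h32', h32r⟩ := threeHalves_facts
    have hm : MemLp (uncurry πv) (3 / 2)
        (volume.restrict (parabolicCylinder 1 (0 : ℝ × EuclideanSpace ℝ (Fin 3)))) := hball.2.2.2
    have h2 := hm.2
    rw [eLpNorm_eq_lintegral_rpow_enorm_toReal (by norm_num) h32', h32r] at h2
    have hfin : ∫⁻ z in parabolicCylinder 1 (0 : ℝ × EuclideanSpace ℝ (Fin 3)),
        ‖uncurry πv z‖ₑ ^ (3 / 2 : ℝ) < ⊤ := by
      by_contra htop
      rw [not_lt, top_le_iff] at htop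
      rw [htop, ENNReal.top_rpow_of_pos (by norm_num)] at h2
      exact lt_irrefl _ h2
    have hfin' : ∫⁻ z in parabolicCylinder (1 / 2) z₀, ‖πv z.1 z.2‖ₑ ^ (3 / 2 : ℝ) < ⊤ := by
      refine lt_of_le_of_lt (lintegral_mono_set ?_) hfin
      rw [hz₀0]
      exact SuitableCompactness.parabolicCylinder_zero_mono (by norm_num) (by norm_num)
    rw [hM₂, cknD]
    exact ENNReal.mul_ne_top (ENNReal.inv_ne_top.2 (pow_ne_zero _ (by simp))) hfin'.ne
  -- ## (3) Seregin–Šverák's iterated pressure decay: plain `D ≤ κ(M₁ + M₂)` on the window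
  obtain ⟨κ, hκ⟩ := exists_cknD_le_window_of_cknC_le
  set K : ℝ≥0∞ := κ * (M₁ + M₂) with hK
  have hKtop : K ≠ ⊤ := ENNReal.mul_ne_top ENNReal.coe_ne_top (ENNReal.add_ne_top.2 ⟨hM₁top, hM₂top⟩)
  have hwin : ∀ z : ℝ × EuclideanSpace ℝ (Fin 3), z.1 ≤ z₀.1 → z₀.1 - 3 / 16 ≤ z.1 →
      dist z.2 z₀.2 < 1 / 4 → ∀ r ∈ Ioc (0 : ℝ) (1 / 4), cknD r z πv ≤ K := by
    intro z hz1 hz2 hz3 r hr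
    have h := hκ (parabolicCylinderOpens 1 (0 : ℝ × EuclideanSpace ℝ (Fin 3))) v πv hdist z₀ (1 / 2)
      (by norm_num) hsub M₁ M₂ hC le_rfl z hz1 (by norm_num at hz2 ⊢; linarith) (by norm_num; exact hz3)
      r ⟨hr.1, by norm_num; exact hr.2⟩
    rw [hK]
    exact h
  -- ## (4) the zoomed pressures of the zoom data are `(μ_j/R)`-zooms of `πv`
  set lam : ℕ → ℝ := fun j => μ j / R with hlam
  have hlampos : ∀ j, 0 < lam j := fun j => show 0 < μ j / R from div_pos (hμ j) hR
  have hlam0 : Tendsto lam atTop (𝓝 0) := by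
    have := hμ0.div_const R
    rwa [zero_div] at this
  have hzoomπ : ∀ j, (lam j) ^ 2 • stPull ((lam j) ^ 2) (lam j) z₀.1 z₀.2 πv =
      (μ j) ^ 2 • stPull ((μ j) ^ 2) (μ j) T x₀ q := by
    intro j
    have e : lam j * R = μ j := by rw [hlam]; field_simp
    show (lam j) ^ 2 • stPull ((lam j) ^ 2) (lam j) (0 : ℝ) (0 : EuclideanSpace ℝ (Fin 3)) πv = _
    rw [hπv1, zoom_zoom_pressure, e]
  have hpm : AEStronglyMeasurable (uncurry πv) (volume.restrict (parabolicCylinder (1 / 2) z₀)) :=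
    hball.2.2.2.1.mono_measure (Measure.restrict_mono (by rwa [coe_parabolicCylinderOpens] at hsub) le_rfl)
  have hπ : ∀ a : ℝ, 0 < a → MemLp (uncurry P) (3 / 2)
      (volume.restrict (parabolicCylinder a (0 : ℝ × EuclideanSpace ℝ (Fin 3)))) :=
    fun a ha => (hdata a ha).2.1
  have hweak : ∀ a : ℝ, 0 < a → ∀ g : ℝ × EuclideanSpace ℝ (Fin 3) → ℝ,
      MemLp g 3 (volume.restrict (parabolicCylinder a (0 : ℝ × EuclideanSpace ℝ (Fin 3)))) →
      Tendsto (fun j => ∫ w' in parabolicCylinder a (0 : ℝ × EuclideanSpace ℝ (Fin 3)),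
          ((lam j) ^ 2 • stPull ((lam j) ^ 2) (lam j) z₀.1 z₀.2 πv) w'.1 w'.2 * g w')
        atTop (𝓝 (∫ w' in parabolicCylinder a (0 : ℝ × EuclideanSpace ℝ (Fin 3)), P w'.1 w'.2 * g w')) := by
    intro a ha g hg
    simp only [hzoomπ]
    exact (hdata a ha).2.2.2 g hg
  -- ## (5) weak lower semicontinuity: the limit pressure inherits `D ≤ K` at every apex
  have hvi : ∀ z : ℝ × EuclideanSpace ℝ (Fin 3), z.1 ≤ 0 → ∀ r : ℝ, 0 < r → cknD r z P ≤ K :=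
    fun z hz r hr => blowup_cknD_le_apex_of_tendsto hpm (by norm_num : (0 : ℝ) < 3 / 16)
      (by norm_num : (0 : ℝ) < 1 / 4) (by norm_num : (0 : ℝ) < 1 / 4) hwin hlampos hlam0 hπ hweak hz hr
  -- ## (6) assemble, with `D₀ = K` as a finite constant
  refine ⟨U, P, G, M, K.toNNReal, C, h1, h2, h3, ?_, h4, h5, h6⟩
  intro z hz r hr
  rw [ENNReal.coe_toNNReal hKtop]
  exact hvi z hz r hr

end Summit.NavierStokesRegularity.NavierStokesRegularity.Theorems.TypeITraceScarL3

end
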